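import Literature.NumberTheory.Automorphic.TunnellOctahedralGlobal
import HarnessLib

/-!
# Non-normal cubic base change for `GL(2)` (Jacquet–Piatetski-Shapiro–Shalika 1981)

Topic `Literature/NumberTheory/Automorphic` (vocabulary: the Borel–Jacquet datum model
`AutomorphicRepData` / `CuspidalAutomorphicRepData` of `AutomorphicRepsGL.lean`, the level
hypothesis `isCompact_glFiniteIntegralLevel` of `GLnAdelicStructure.lean`, and
`IsWeakBaseChangeLiftAE` of `TunnellOctahedralGlobal.lean`). ONE named fact, vendored by the
librarian (sweep g23, 2026-08-16, promote event 1809365; the provefact seat of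
`tunnell_cuspidal_cubic_lifts` drafted this file in 23 sessions but cannot mint facts,
`lint.fact-fanout`) from a hypothesis binder that occurs VERBATIM in an accepted theorem of the
tree: `h1` of
`Literature.NumberTheory.Automorphic.tunnell_cuspidal_cubic_lifts_of_jpss_of_langlandsLemma`
(`TunnellCubicLiftsOfLanglandsLemma.lean`), which proves the crux `tunnell_cuspidal_cubic_lifts`
(hence `tunnell_lemma` and `strongArtin_of_isOctahedralType`) from exactly this fact and Langlands'
lemma for `GL₂` (its `hL`).

* `JPSS1981_exists_weakBaseChangeLift_cubic` — **Jacquet–Piatetski-Shapiro–Shalika 1981**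
  (C. R. Acad. Sci. 292; = Tunnell 1981, Theorem [4], pp. 173–174, quoted there verbatim: "Let `K`
  be a cubic extension of `F` (not necessarily Galois). For each automorphic cuspidal
  representation `π` of `GL(2, 𝔸_F)` there exists an automorphic representation `Π = BC_{K/F}(π)`
  of `GL(2, 𝔸_K)` such that for almost all places `v` of `F`, and each place `w` of `K` dividing
  `v`, [`Π_w` is the lift of `π_v`]"; Gelbart 1997, §7.2, Proposition p. 258): for number fields
  `K/F` with `[K : F] = 3` and every cuspidal `π` on `GL₂/F`, there is an automorphic `P` on `GL₂/K`
  which is a weak base-change lift of `π` almost everywhere (`IsWeakBaseChangeLiftAE`: at almost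
  every `w | v`, the Satake parameters of `P_w` are the `f(w|v)`-th powers of those of `π_v`).

The statement is a theorem in print, NOT proved here (`def … : Prop`, D-0014); its discharge would
be `theorem JPSS1981_exists_weakBaseChangeLift_cubic_holds`. Source reading: the consumer's
docstring (provefact seat, 2026-08-15/16), which quotes Tunnell's Theorem [4] against the binder.

## References

* H. Jacquet, I. Piatetski-Shapiro, J. Shalika, *Relèvement cubique non normal*, C. R. Acad.
  Sci. Paris 292 (1981). [JPSS1981Cubique]
* J. Tunnell, *Artin's conjecture for representations of octahedral type*, Bull. Amer. Math. Soc.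
  5 (1981), 173–175, Theorem [4]. [Tunnell1981]
* S. Gelbart, *Three lectures on the modularity of `\bar ρ_{E,3}` and the Langlands reciprocity
  conjecture*, in: Modular Forms and Fermat's Last Theorem (1997), §7.2. [Gelbart1997]
-/

open scoped MatrixGroups NumberField Polynomial Classical
open NumberField IsDedekindDomain Field Polynomial Filter

namespace Literature.NumberTheory.Automorphic

/-- **Jacquet–Piatetski-Shapiro–Shalika 1981: non-normal cubic base change for `GL(2)`**
(= Tunnell 1981, Theorem [4]; Gelbart 1997, §7.2 Prop. p. 258): for number fields `K/F` of degree
`3` (not necessarily Galois) every cuspidal automorphic `π` of `GL₂(𝔸_F)` admits an automorphic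
`P` of `GL₂(𝔸_K)` that is a weak base-change lift of `π` at almost all places. VERBATIM the
hypothesis `h1` of `tunnell_cuspidal_cubic_lifts_of_jpss_of_langlandsLemma`.
[cite: JPSS1981Cubique] [cite: Tunnell1981, Theorem [4] (pp. 173–174)]
[cite: Gelbart1997, §7.2 Proposition (p. 258)] -/
def JPSS1981_exists_weakBaseChangeLift_cubic : Prop :=
  ∀ (F K : Type) [Field F] [NumberField F] [Field K] [NumberField K] [Algebra F K],
    Module.finrank F K = 3 →
    ∀ (hF : isCompact_glFiniteIntegralLevel 2 F) (hK : isCompact_glFiniteIntegralLevel 2 K)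
      (π : CuspidalAutomorphicRepData 2 F hF),
      ∃ P : AutomorphicRepData (AutomorphyDatum.gl 2 K hK), IsWeakBaseChangeLiftAE π.1 P

end Literature.NumberTheory.Automorphic
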